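import Literature.NumberTheory.Automorphic.UnitaryGroupRankOneBigCell
import Literature.NumberTheory.Automorphic.HyperspecialUnitaryIwasawa
import Literature.NumberTheory.Automorphic.HermitianLatticesLocal
import HarnessLib

/-!
# Flicker's double-coset decomposition `G = ⊔_{m ≥ 0} H · u_m · K` of the quasi-split `p`-adic `U(3)` (`H ≅ U(1,1) × U(1)`, `K` hyperspecial)
# (Flicker 1998, «Elementary proof of the fundamental lemma for a unitary group», Prop. 4 pp. 80–81) — file 1: the elements `u_m`, existence, disjointness

Topic `NumberTheory/Automorphic`; namespace `Literature.NumberTheory.Automorphic.UnitaryGroup`.  THEOREMS ONLY (no `def`, no instance, no notation, no named fact,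
no `sorry`).  Cell `pub/hodgecm-mathlib`, ENGINE T1 (crux H413 = `stmt-HodgeConjecture-24833`); books row #103-ns (N7-ns, `UnitFundamentalLemmaExplicitNonsplitClosed`),
road «N7-ns COUNT FROM FLICKER» (MAP v3 a5916cc7, architect A-p06 (g26); line `F0_P3a_N7nsCount`), brick **(F1)** (LEAD F0P3a-plan (g9) T8-41; architect «= Φ₃-NATIVE»
03:57:57Z; author B-p17 (g24), 2026-09-01).  Consumers: (F2) unfolding (B-p12), (F3c) `H`-decompositions (B-p04), (F4)∕(F7) volumes (A-p03) — all read `u_m` and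
`H^K_m` (file 2 `UnitaryThreeDoubleCosetsHKStabilizer`).

FRAME (one currency for the road): `K` a field with `Valued K ℤᵐ⁰` and a ★ `LocalConjDatum σ ϖ` (`σ` an isometric involution, `ϖ` a `σ`-fixed uniformiser,
`|2| = 1`); `U = U(σ, Φ₃)(K)`, `Φ₃ = antidiag(1,1,1)` (★ `unitaryGroupOfForm`, `hJ : J = (StdForm.antidiagonal 3).over K`); `K₀ = U ∩ GL₃(𝒪)` = ★
`HermitianLattice.unitaryInt σ J` (by ENTRIES, `mem_unitaryInt_iff_forall_v_apply_le_one`); `c ∈ U` with matrix `diag(1,−1,1)` and **`H = Z_U(c)`**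
(`Subgroup.centralizer {c}`; Flicker's `H = U(1,1) × U(1)`, the tree's `ι(U(Φ₂) × U(Φ₁))`); `y ∈ K` with **`y·σy = −2`** (exists at an unramified place: Flicker's
`x x̄ = 2` carried along the congruence `diag(1,d,1)`, `dσd = −1`, which takes his `J = antidiag(1,−1,1)` to `Φ₃` and fixes `H`, `K₀`, the torus — (F0) ★
`UnitFundamentalLemmaInertFlickerFrame` records it); **`u_m = u(y,1)·d(ϖ^m,1,ϖ^{-m}) = !![ϖ^m, y, ϖ^{-m}; 0, 1, −σy·ϖ^{-m}; 0, 0, ϖ^{-m}]`** (Flicker's `u_m = u₀ d_m`).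

WHAT IS PROVED.
* §1 `exists_coe_eq_flickerU` — `u_m ∈ U` (constructor); `mem_unitaryInt_iff_forall_v_apply_le_one` (`K₀` by entries).
* §2 `apply_eq_zero_of_mem_centralizer` (`h ∈ H ⇒ h = !![α,0,β;0,e,0;γ,0,δ]`), `v_apply_one_one_eq_one_of_mem_centralizer` (`|e| = 1`), `v_mul_apply_one_eq_of_mem_centralizer`
  ∕ `v_mul_apply_one_le_of_mem_unitaryInt` (the middle row under `H` on the left ∕ `K₀` on the right), and **`eq_of_centralizer_mul_flickerU_mul_unitaryInt_eq`**:
  `h u_m k = h′ u_n k′ ⇒ m = n` — THE DOUBLE COSETS `H u_m K₀` ARE PAIRWISE DISJOINT (invariant: the sup of the middle-row valuations, `= |ϖ|^{-m}` on `H u_m K₀`).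
* §3 `mem_centralizer_of_mem_torusU` (`T ≤ H`), `mem_centralizer_of_coe_eq_upper_zero` (`u(0,z) ∈ H`), and **`exists_mem_centralizer_mul_flickerU_mul_mem_unitaryInt`**:
  EVERY `g ∈ U` is `h · u_m · k`, `m ≥ 0`, `h ∈ H`, `k ∈ K₀` — `U = ⊔_{m≥0} H u_m K₀` (Iwasawa ★ `HermitianLattice.exists_eq_upper_mul_unitaryInt`, `b = nτ` ★
  `exists_unipotent_mul_torus_of_mem_borelOfForm`, `u(w,z) = u(0, z + wσw∕2)·u(w, −wσw∕2)`, `u(w,−wσw∕2) = d(w∕y,1,·)·u_m·d(ε⁻¹,1,σε)` with `w∕y = εϖ^{-m}`).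
NOT HERE: the stabiliser `H^K_m = H ∩ u_m K₀ u_m⁻¹` (file 2); the unfolding of the orbital integral (F2); measures.  HONEST LABEL: HC_CM is proved only modulo the printed citations
until rung 0 closes; this is structure theory feeding ONE clause of #103-ns and pays nothing by itself.

## References
* [Flicker1998UnitaryFL] Y. Z. Flicker, *Elementary proof of the fundamental lemma for a unitary group*, Canad. J. Math. 50 (1998), §2 p. 78 (`J`, `H`), §3 Prop. 4 pp. 80–81
  (held text `shelf/Flicker1998-CJM50-UnitaryFL/p0007–p0008`).
* [Rogawski1990] J. D. Rogawski, *Automorphic Representations of Unitary Groups in Three Variables* (1990), §1.9–§1.10 pp. 8–9 (`Φ`, `B = MN`, `u(x,z)`), §4.5 p. 45 (Iwasawa).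
* [BruhatTits1972] F. Bruhat, J. Tits, *Groupes réductifs sur un corps local I*, Publ. IHÉS 41 (1972), (4.4.3) (Iwasawa `G = BK`). -/

set_option autoImplicit false

open scoped MatrixGroups WithZero
open Matrix

namespace Literature.NumberTheory.Automorphic

namespace UnitaryGroup

open Literature.NumberTheory.Automorphic.HermitianLattice (unitaryInt mem_unitaryInt_iff LocalConjDatum)

section Setting

variable {K : Type*} [Field K] [Valued K ℤᵐ⁰] {ϖ : K}
  (σ : K →+* K) {J : Matrix (Fin 3) (Fin 3) K} (hJ : J = (StdForm.antidiagonal 3).over K)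

/-- `rev` on `Fin 3`. [folklore] -/ private theorem rev0'' : Fin.rev (0 : Fin 3) = 2 := rfl
/-- `rev` on `Fin 3`. [folklore] -/ private theorem rev1'' : Fin.rev (1 : Fin 3) = 1 := rfl
/-- `rev` on `Fin 3`. [folklore] -/ private theorem rev2'' : Fin.rev (2 : Fin 3) = 0 := rfl

omit [Valued K ℤᵐ⁰] in
include hJ in
/-- Constructor: a `3 × 3` matrix with non-zero determinant satisfying the nine unitarity relations is (the matrix of) an element
of `U(σ, Φ₃)`. [folklore] -/
private theorem exists_coe_eq_of_sum (M : Matrix (Fin 3) (Fin 3) K) (hdet : M.det ≠ 0)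
    (hsum : ∀ a b : Fin 3, ∑ i, σ (M i a) * M (Fin.rev i) b = if b = Fin.rev a then 1 else 0) :
    ∃ g : ↥(unitaryGroupOfForm σ J), ((g : GL (Fin 3) K) : Matrix (Fin 3) (Fin 3) K) = M := by
  have hmem : Matrix.GeneralLinearGroup.mkOfDetNeZero M hdet ∈ unitaryGroupOfForm σ J := by
    rw [hJ, mem_unitaryGroupOfForm_antidiagonal_iff_sum']
    simpa [Matrix.GeneralLinearGroup.val_mkOfDetNeZero] using hsum
  exact ⟨⟨_, hmem⟩, Matrix.GeneralLinearGroup.val_mkOfDetNeZero _ _⟩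

include hJ in
/-- `K₀ = U ∩ GL₃(𝒪)` (★ `unitaryInt`) is cut out by the ENTRIES of `g` alone when `σ` preserves the valuation
(`(g⁻¹)_{ij} = σ(g_{2−j,2−i})`). [cite: Rogawski1990, §1.9 p. 8] -/
theorem mem_unitaryInt_iff_forall_v_apply_le_one (hσv : ∀ x, Valued.v (σ x) = Valued.v x)
    (g : ↥(unitaryGroupOfForm σ J)) :
    g ∈ unitaryInt σ J ↔ ∀ i j, Valued.v (((g : GL (Fin 3) K) : Matrix (Fin 3) (Fin 3) K) i j) ≤ 1 := by
  rw [mem_unitaryInt_iff]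
  refine ⟨fun h => h.1, fun h => ⟨h, fun i j => ?_⟩⟩
  rw [inv_apply_of_mem σ hJ g i j, hσv]
  exact h _ _

/-! ## §1 Flicker's elements `u_m = u₀ · d_m` in the quasi-split frame -/

include hJ in
/-- **Flicker's `u_m = u₀ d_m`** in the tree's quasi-split frame `Φ₃ = antidiag(1,1,1)`: for `y` with `y·σy = −2` (the image of Flicker's
`x`, `x x̄ = 2`, under the diagonal congruence `diag(1,d,1)`, `d σd = −1`, carrying his `J = antidiag(1,−1,1)` to `Φ₃`) and `t = ϖ^m`,
the matrix `!![t, y, t⁻¹; 0, 1, −σy·t⁻¹; 0, 0, t⁻¹] = u(y, 1) · d(t, 1, t⁻¹)` is an element of `U(σ, Φ₃)`.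
[cite: Flicker1998UnitaryFL, Prop. 4 p. 80] -/
theorem exists_coe_eq_flickerU (hd : LocalConjDatum σ ϖ) {y : K} (hy : y * σ y = -2) (m : ℕ) :
    ∃ u : ↥(unitaryGroupOfForm σ J), ((u : GL (Fin 3) K) : Matrix (Fin 3) (Fin 3) K) =
      !![ϖ ^ m, y, (ϖ ^ m)⁻¹; 0, 1, -σ y * (ϖ ^ m)⁻¹; 0, 0, (ϖ ^ m)⁻¹] := by
  have hϖ0 : ϖ ≠ 0 := by
    intro h; have := hd.vϖ; rw [h, map_zero] at this; exact WithZero.zero_ne_coe this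
  have ht0 : ϖ ^ m ≠ 0 := pow_ne_zero _ hϖ0
  have hσt : σ (ϖ ^ m) = ϖ ^ m := by rw [map_pow, hd.σϖ]
  have hσy : σ (σ y) = y := hd.σσ y
  have hyσ : σ y * y = -2 := by rw [mul_comm]; exact hy
  refine exists_coe_eq_of_sum σ hJ _ ?_ ?_
  · rw [Matrix.det_fin_three]; simp [ht0]
  · intro a b
    fin_cases a <;> fin_cases b <;>
      simp [Fin.sum_univ_three, rev1'', rev2'', map_neg, map_mul, map_inv₀, hσt, hσy, ht0]
    · ring
    · linear_combination (ϖ ^ m)⁻¹ * (ϖ ^ m)⁻¹ * hy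

/-! ## §2 The subgroup `H = Z_U(diag(1,−1,1))`: shape of its elements; the middle-row invariant -/

omit [Valued K ℤᵐ⁰] in
/-- An element of `U` commuting with `c = diag(1,−1,1)` has the block shape `!![α,0,β; 0,e,0; γ,0,δ]` (residue characteristic `≠ 2`):
its four entries `(0,1),(1,0),(1,2),(2,1)` vanish. [cite: Flicker1998UnitaryFL, §2 p. 78] -/
theorem apply_eq_zero_of_mem_centralizer (h2 : (2 : K) ≠ 0) {c h : ↥(unitaryGroupOfForm σ J)}
    (hc : ((c : GL (Fin 3) K) : Matrix (Fin 3) (Fin 3) K) = !![1, 0, 0; 0, -1, 0; 0, 0, 1])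
    (hh : h ∈ Subgroup.centralizer ({c} : Set ↥(unitaryGroupOfForm σ J))) :
    ((h : GL (Fin 3) K) : Matrix (Fin 3) (Fin 3) K) 0 1 = 0 ∧ ((h : GL (Fin 3) K) : Matrix (Fin 3) (Fin 3) K) 1 0 = 0 ∧
      ((h : GL (Fin 3) K) : Matrix (Fin 3) (Fin 3) K) 1 2 = 0 ∧ ((h : GL (Fin 3) K) : Matrix (Fin 3) (Fin 3) K) 2 1 = 0 := by
  have hcomm := Subgroup.mem_centralizer_singleton_iff.1 hh
  have hM : ((c : GL (Fin 3) K) : Matrix (Fin 3) (Fin 3) K) * ((h : GL (Fin 3) K) : Matrix (Fin 3) (Fin 3) K) =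
      ((h : GL (Fin 3) K) : Matrix (Fin 3) (Fin 3) K) * ((c : GL (Fin 3) K) : Matrix (Fin 3) (Fin 3) K) := by
    rw [← Units.val_mul, ← Units.val_mul, ← Subgroup.coe_mul, ← Subgroup.coe_mul, hcomm]
  rw [hc] at hM
  set M := ((h : GL (Fin 3) K) : Matrix (Fin 3) (Fin 3) K) with hMdef
  have e01 := congrFun (congrFun hM 0) 1; have e10 := congrFun (congrFun hM 1) 0
  have e12 := congrFun (congrFun hM 1) 2; have e21 := congrFun (congrFun hM 2) 1
  simp [Matrix.mul_apply, Fin.sum_univ_three] at e01 e10 e12 e21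
  refine ⟨(mul_eq_zero.1 (?_ : (2 : K) * M 0 1 = 0)).resolve_left h2, (mul_eq_zero.1 (?_ : (2 : K) * M 1 0 = 0)).resolve_left h2,
    (mul_eq_zero.1 (?_ : (2 : K) * M 1 2 = 0)).resolve_left h2, (mul_eq_zero.1 (?_ : (2 : K) * M 2 1 = 0)).resolve_left h2⟩
  · linear_combination e01
  · linear_combination -e10
  · linear_combination -e12
  · linear_combination e21

include hJ in
/-- For `h ∈ H`, the middle entry `h₁₁` is a unit of valuation `1` (`σ(h₁₁)·h₁₁ = 1` from unitarity, the other two terms of the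
relation vanishing by the block shape). [cite: Flicker1998UnitaryFL, §2 p. 78] -/
theorem v_apply_one_one_eq_one_of_mem_centralizer (hσv : ∀ x, Valued.v (σ x) = Valued.v x) (h2 : (2 : K) ≠ 0)
    {c h : ↥(unitaryGroupOfForm σ J)} (hc : ((c : GL (Fin 3) K) : Matrix (Fin 3) (Fin 3) K) = !![1, 0, 0; 0, -1, 0; 0, 0, 1])
    (hh : h ∈ Subgroup.centralizer ({c} : Set ↥(unitaryGroupOfForm σ J))) :
    Valued.v (((h : GL (Fin 3) K) : Matrix (Fin 3) (Fin 3) K) 1 1) = 1 := by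
  obtain ⟨h01, -, -, h21⟩ := apply_eq_zero_of_mem_centralizer σ h2 hc hh
  have hrel := sum_rel_of_mem σ hJ h 1 1
  simp only [Fin.sum_univ_three, rev0'', rev1'', rev2'', h01, h21, map_zero, mul_zero, zero_add, add_zero, if_true] at hrel
  have hv := congrArg Valued.v hrel
  rw [map_mul, hσv, map_one] at hv
  exact Literature.NumberTheory.QuadraticForms.OMeara65.WithZeroMulInt.eq_one_of_mul_self hv

include hJ in
/-- Left multiplication by `h ∈ H` multiplies the middle row by the unit `h₁₁`: `(h g)₁ⱼ = h₁₁ g₁ⱼ`, so middle-row valuations are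
unchanged. [cite: Flicker1998UnitaryFL, Prop. 4 p. 81] -/
theorem v_mul_apply_one_eq_of_mem_centralizer (hσv : ∀ x, Valued.v (σ x) = Valued.v x) (h2 : (2 : K) ≠ 0)
    {c h : ↥(unitaryGroupOfForm σ J)} (hc : ((c : GL (Fin 3) K) : Matrix (Fin 3) (Fin 3) K) = !![1, 0, 0; 0, -1, 0; 0, 0, 1])
    (hh : h ∈ Subgroup.centralizer ({c} : Set ↥(unitaryGroupOfForm σ J))) (g : ↥(unitaryGroupOfForm σ J)) (j : Fin 3) :
    Valued.v ((((h * g : ↥(unitaryGroupOfForm σ J)) : GL (Fin 3) K) : Matrix (Fin 3) (Fin 3) K) 1 j) =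
      Valued.v (((g : GL (Fin 3) K) : Matrix (Fin 3) (Fin 3) K) 1 j) := by
  obtain ⟨-, h10, h12, -⟩ := apply_eq_zero_of_mem_centralizer σ h2 hc hh
  rw [Subgroup.coe_mul, Units.val_mul, Matrix.mul_apply, Fin.sum_univ_three, h10, h12, zero_mul, zero_mul, zero_add, add_zero,
    map_mul, v_apply_one_one_eq_one_of_mem_centralizer σ hJ hσv h2 hc hh, one_mul]

include hJ in
/-- Right multiplication by `k ∈ K₀` does not increase the middle-row valuations (ultrametric inequality; applied to `k` and `k⁻¹`
it preserves their maximum). [cite: Flicker1998UnitaryFL, Prop. 4 p. 81] -/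
theorem v_mul_apply_one_le_of_mem_unitaryInt (hσv : ∀ x, Valued.v (σ x) = Valued.v x) (g : ↥(unitaryGroupOfForm σ J))
    {k : ↥(unitaryGroupOfForm σ J)} (hk : k ∈ unitaryInt σ J) {M : ℤᵐ⁰}
    (hg : ∀ l, Valued.v (((g : GL (Fin 3) K) : Matrix (Fin 3) (Fin 3) K) 1 l) ≤ M) (j : Fin 3) :
    Valued.v ((((g * k : ↥(unitaryGroupOfForm σ J)) : GL (Fin 3) K) : Matrix (Fin 3) (Fin 3) K) 1 j) ≤ M := by
  have hk' := (mem_unitaryInt_iff_forall_v_apply_le_one σ hJ hσv k).1 hk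
  rw [Subgroup.coe_mul, Units.val_mul, Matrix.mul_apply, Fin.sum_univ_three]
  refine Valued.v.map_add_le (Valued.v.map_add_le ?_ ?_) ?_ <;> rw [map_mul] <;>
    exact (mul_le_mul' (hg _) (hk' _ _)).trans_eq (mul_one M)

include hJ in
/-- **The double cosets `H u_m K₀` are pairwise distinct**: the supremum of the middle-row valuations is an invariant of `H g K₀`
(`H` scales the middle row by a unit, `K₀` preserves integrality), and on `u_m` it equals `|ϖ|^{-m}` (the entry `−σy·ϖ^{-m}`, `|y| = 1`
since `|2| = 1`). [cite: Flicker1998UnitaryFL, Prop. 4 p. 81] -/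
theorem eq_of_centralizer_mul_flickerU_mul_unitaryInt_eq (hd : LocalConjDatum σ ϖ) {y : K} (hy : y * σ y = -2)
    {c : ↥(unitaryGroupOfForm σ J)} (hc : ((c : GL (Fin 3) K) : Matrix (Fin 3) (Fin 3) K) = !![1, 0, 0; 0, -1, 0; 0, 0, 1])
    {m n : ℕ} {h u k h' u' k' : ↥(unitaryGroupOfForm σ J)}
    (hh : h ∈ Subgroup.centralizer ({c} : Set ↥(unitaryGroupOfForm σ J)))
    (hu : ((u : GL (Fin 3) K) : Matrix (Fin 3) (Fin 3) K) = !![ϖ ^ m, y, (ϖ ^ m)⁻¹; 0, 1, -σ y * (ϖ ^ m)⁻¹; 0, 0, (ϖ ^ m)⁻¹])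
    (hk : k ∈ unitaryInt σ J)
    (hh' : h' ∈ Subgroup.centralizer ({c} : Set ↥(unitaryGroupOfForm σ J)))
    (hu' : ((u' : GL (Fin 3) K) : Matrix (Fin 3) (Fin 3) K) = !![ϖ ^ n, y, (ϖ ^ n)⁻¹; 0, 1, -σ y * (ϖ ^ n)⁻¹; 0, 0, (ϖ ^ n)⁻¹])
    (hk' : k' ∈ unitaryInt σ J) (heq : h * u * k = h' * u' * k') : m = n := by
  have h2 : (2 : K) ≠ 0 := fun h0 => by have := hd.v2; rw [h0, map_zero] at this; exact zero_ne_one this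
  have hvy : Valued.v y = 1 := by
    have hv := congrArg Valued.v hy
    rw [map_mul, hd.vσ, Valuation.map_neg, hd.v2] at hv
    exact Literature.NumberTheory.QuadraticForms.OMeara65.WithZeroMulInt.eq_one_of_mul_self hv
  have hvσy : Valued.v (σ y) = 1 := by rw [hd.vσ, hvy]
  -- the middle row of `u_p` has valuations `0, 1, exp p`
  have row : ∀ {p : ℕ} {w : ↥(unitaryGroupOfForm σ J)},
      ((w : GL (Fin 3) K) : Matrix (Fin 3) (Fin 3) K) = !![ϖ ^ p, y, (ϖ ^ p)⁻¹; 0, 1, -σ y * (ϖ ^ p)⁻¹; 0, 0, (ϖ ^ p)⁻¹] →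
      (∀ l, Valued.v (((w : GL (Fin 3) K) : Matrix (Fin 3) (Fin 3) K) 1 l) ≤ WithZero.exp (p : ℤ)) ∧
        Valued.v (((w : GL (Fin 3) K) : Matrix (Fin 3) (Fin 3) K) 1 2) = WithZero.exp (p : ℤ) := by
    intro p w hw
    have h12 : Valued.v (((w : GL (Fin 3) K) : Matrix (Fin 3) (Fin 3) K) 1 2) = WithZero.exp (p : ℤ) := by
      rw [hw]; simp [map_mul, map_inv₀, map_pow, hvσy, hd.vϖ, ← WithZero.exp_nsmul]
    refine ⟨fun l => ?_, h12⟩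
    fin_cases l
    · simp [hw]
    · have h11 : ((w : GL (Fin 3) K) : Matrix (Fin 3) (Fin 3) K) 1 1 = 1 := by rw [hw]; rfl
      simp only [Fin.mk_one, h11, map_one, ← WithZero.exp_zero, WithZero.exp_le_exp]
      exact_mod_cast Nat.zero_le p
    · exact h12.le
  -- `exp m = |(u_m)₁₂| ≤ sup of the middle row of g ≤ exp n`, and symmetrically
  have key : ∀ {p q : ℕ} {a v b a' v' b' : ↥(unitaryGroupOfForm σ J)},
      a ∈ Subgroup.centralizer ({c} : Set ↥(unitaryGroupOfForm σ J)) →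
      ((v : GL (Fin 3) K) : Matrix (Fin 3) (Fin 3) K) = !![ϖ ^ p, y, (ϖ ^ p)⁻¹; 0, 1, -σ y * (ϖ ^ p)⁻¹; 0, 0, (ϖ ^ p)⁻¹] →
      b ∈ unitaryInt σ J → a' ∈ Subgroup.centralizer ({c} : Set ↥(unitaryGroupOfForm σ J)) →
      ((v' : GL (Fin 3) K) : Matrix (Fin 3) (Fin 3) K) = !![ϖ ^ q, y, (ϖ ^ q)⁻¹; 0, 1, -σ y * (ϖ ^ q)⁻¹; 0, 0, (ϖ ^ q)⁻¹] →
      b' ∈ unitaryInt σ J → a * v * b = a' * v' * b' → p ≤ q := by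
    intro p q a v b a' v' b' ha hv hb ha' hv' hb' he
    -- middle row of `g = a' v' b'` is bounded by `exp q`
    have hg : ∀ l, Valued.v ((((a' * v' * b' : ↥(unitaryGroupOfForm σ J)) : GL (Fin 3) K) : Matrix (Fin 3) (Fin 3) K) 1 l) ≤
        WithZero.exp (q : ℤ) := fun l => by
      rw [mul_assoc, v_mul_apply_one_eq_of_mem_centralizer σ hJ hd.vσ h2 hc ha']
      exact v_mul_apply_one_le_of_mem_unitaryInt σ hJ hd.vσ v' hb' (row hv').1 l
    -- `v = a⁻¹ g b⁻¹`
    have hv_eq : v = a⁻¹ * (a' * v' * b') * b⁻¹ := by rw [← he]; group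
    have h1 : Valued.v (((v : GL (Fin 3) K) : Matrix (Fin 3) (Fin 3) K) 1 2) ≤ WithZero.exp (q : ℤ) := by
      rw [hv_eq]
      refine v_mul_apply_one_le_of_mem_unitaryInt σ hJ hd.vσ _ ((unitaryInt σ J).inv_mem hb) (fun l => ?_) 2
      rw [v_mul_apply_one_eq_of_mem_centralizer σ hJ hd.vσ h2 hc ((Subgroup.centralizer _).inv_mem ha)]
      exact hg l
    rw [(row hv).2, WithZero.exp_le_exp] at h1
    exact_mod_cast h1
  exact le_antisymm (key hh hu hk hh' hu' hk' heq) (key hh' hu' hk' hh hu hk heq.symm)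

/-! ## §3 The decomposition `U = ⋃_{m ≥ 0} H · u_m · K₀` -/

omit [Valued K ℤᵐ⁰] in
include hJ in
/-- A diagonal element of `U` (an element of the torus `T`) commutes with `c = diag(1,−1,1)`: `T ≤ H`. [cite: Flicker1998UnitaryFL, §3 p. 80] -/
theorem mem_centralizer_of_mem_torusU {c t : ↥(unitaryGroupOfForm σ J)}
    (hc : ((c : GL (Fin 3) K) : Matrix (Fin 3) (Fin 3) K) = !![1, 0, 0; 0, -1, 0; 0, 0, 1]) (ht : t ∈ torusU σ J) :
    t ∈ Subgroup.centralizer ({c} : Set ↥(unitaryGroupOfForm σ J)) := by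
  obtain ⟨d, hd, -⟩ := exists_coe_eq_diagonal_of_mem_torusU σ hJ ht
  rw [Subgroup.mem_centralizer_singleton_iff]
  apply Subtype.ext; apply Units.ext
  rw [Subgroup.coe_mul, Subgroup.coe_mul, Units.val_mul, Units.val_mul, hc, hd]
  ext i j
  fin_cases i <;> fin_cases j <;> simp [Matrix.mul_apply, Matrix.diagonal]

omit [Valued K ℤᵐ⁰] in
/-- The unipotent `u(0, z)` (`z + σz = 0`) commutes with `c = diag(1,−1,1)`: `N ∩ H ∋ u(0,z)`. [cite: Flicker1998UnitaryFL, Prop. 4 p. 81] -/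
theorem mem_centralizer_of_coe_eq_upper_zero {c n : ↥(unitaryGroupOfForm σ J)}
    (hc : ((c : GL (Fin 3) K) : Matrix (Fin 3) (Fin 3) K) = !![1, 0, 0; 0, -1, 0; 0, 0, 1]) {z : K}
    (hn : ((n : GL (Fin 3) K) : Matrix (Fin 3) (Fin 3) K) = !![1, 0, z; 0, 1, 0; 0, 0, 1]) :
    n ∈ Subgroup.centralizer ({c} : Set ↥(unitaryGroupOfForm σ J)) := by
  rw [Subgroup.mem_centralizer_singleton_iff]
  apply Subtype.ext; apply Units.ext
  rw [Subgroup.coe_mul, Subgroup.coe_mul, Units.val_mul, Units.val_mul, hc, hn]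
  ext i j
  fin_cases i <;> fin_cases j <;> simp [Matrix.mul_apply, Fin.sum_univ_three]

set_option maxHeartbeats 400000 in
include hJ in
/-- **(F1) FLICKER'S DOUBLE-COSET DECOMPOSITION `G = ⋃_{m ≥ 0} H u_m K`** [Flicker1998UnitaryFL Prop. 4, pp. 80–81], in the tree's
quasi-split frame: `K` a non-archimedean local-type valued field with a `LocalConjDatum σ ϖ` (isometric involution `σ`, `σ`-fixed uniformiser
`ϖ`, `|2| = 1`), `y σy = −2` (unramifiedness), `U = U(σ, Φ₃)(K)`, `H = Z_U(c)`, `c = diag(1,−1,1)` (`≅ U(1,1) × U(1)`), `K₀ = U ∩ GL₃(𝒪)` (★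
`unitaryInt`), `u_m = !![ϖ^m, y, ϖ^{-m}; 0, 1, −σy ϖ^{-m}; 0, 0, ϖ^{-m}]`: EVERY `g ∈ U` is `h · u_m · k` with `m ≥ 0`, `h ∈ H`, `k ∈ K₀`.
Proof (print's, p. 81): Iwasawa `g = b k` (★ `HermitianLattice.exists_eq_upper_mul_unitaryInt`), `b = n τ`, `T ≤ H`; the unipotent
`u(w, z) = u(0, z + wσw∕2) · u(w, −wσw∕2)` with `u(0,·) ∈ H`; if `|w| ≤ 1` then `u(w, −wσw∕2) ∈ K₀` (`m = 0`), else `w∕y = ε ϖ^{-m}`,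
`|ε| = 1`, and `u(w, −wσw∕2) = d(w∕y, 1, ·) · u_m · d(ε⁻¹, 1, σε)` with `d(w∕y,1,·) ∈ T ≤ H`, `d(ε⁻¹,1,σε) ∈ K₀`.
[cite: Flicker1998UnitaryFL, Prop. 4 pp. 80–81] -/
theorem exists_mem_centralizer_mul_flickerU_mul_mem_unitaryInt (hd : LocalConjDatum σ ϖ) {y : K} (hy : y * σ y = -2)
    {c : ↥(unitaryGroupOfForm σ J)} (hc : ((c : GL (Fin 3) K) : Matrix (Fin 3) (Fin 3) K) = !![1, 0, 0; 0, -1, 0; 0, 0, 1])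
    (g : ↥(unitaryGroupOfForm σ J)) :
    ∃ (m : ℕ) (h u k : ↥(unitaryGroupOfForm σ J)), h ∈ Subgroup.centralizer ({c} : Set ↥(unitaryGroupOfForm σ J)) ∧
      ((u : GL (Fin 3) K) : Matrix (Fin 3) (Fin 3) K) = !![ϖ ^ m, y, (ϖ ^ m)⁻¹; 0, 1, -σ y * (ϖ ^ m)⁻¹; 0, 0, (ϖ ^ m)⁻¹] ∧
      k ∈ unitaryInt σ J ∧ g = h * u * k := by
  subst hJ
  -- scalar facts
  have h2 : (2 : K) ≠ 0 := fun h0 => by have := hd.v2; rw [h0, map_zero] at this; exact zero_ne_one this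
  have hvy : Valued.v y = 1 := by
    have hv := congrArg Valued.v hy
    rw [map_mul, hd.vσ, Valuation.map_neg, hd.v2] at hv
    exact Literature.NumberTheory.QuadraticForms.OMeara65.WithZeroMulInt.eq_one_of_mul_self hv
  have hy0 : y ≠ 0 := fun h0 => by rw [h0, map_zero] at hvy; exact zero_ne_one hvy
  have hσy0 : σ y ≠ 0 := (map_ne_zero σ).2 hy0
  have hvσy : Valued.v (σ y) = 1 := by rw [hd.vσ, hvy]
  have hϖ0 : ϖ ≠ 0 := fun h0 => by have := hd.vϖ; rw [h0, map_zero] at this; exact WithZero.zero_ne_coe this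
  have hσσ := hd.σσ
  -- Iwasawa `g = b k`, Levi `b = n τ`, and `g = τ (τ⁻¹ n τ) k`
  obtain ⟨b, k, hk, hbtri, hgbk⟩ := HermitianLattice.exists_eq_upper_mul_unitaryInt hd.σσ hd.vσ g
  obtain ⟨u₁, hu₁, d, hdT, -, hbud⟩ := exists_unipotent_mul_torus_of_mem_borelOfForm (σ := σ) (N := 3)
    ((mem_borelU_iff_mem_borelOfForm rfl b).1 hbtri)
  have huU : u₁ ∈ unitaryGroupOfForm σ ((StdForm.antidiagonal 3).over K) := hu₁.1
  have hdU : glDiagonal 3 K d ∈ unitaryGroupOfForm σ ((StdForm.antidiagonal 3).over K) := hdT.1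
  set n : ↥(unitaryGroupOfForm σ ((StdForm.antidiagonal 3).over K)) := ⟨u₁, huU⟩ with hndef
  set τ : ↥(unitaryGroupOfForm σ ((StdForm.antidiagonal 3).over K)) := ⟨glDiagonal 3 K d, hdU⟩ with hτdef
  have hn : n ∈ unipotentU σ ((StdForm.antidiagonal 3).over K) := hu₁.2
  have hτ : τ ∈ torusU σ ((StdForm.antidiagonal 3).over K) := ⟨d, rfl⟩
  have hbnt : b = n * τ := Subtype.ext hbud
  have hτH := mem_centralizer_of_mem_torusU σ rfl hc hτ
  have hn' : τ⁻¹ * n * τ ∈ unipotentU σ ((StdForm.antidiagonal 3).over K) := inv_mul_mul_mem_unipotentU σ rfl hτ hn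
  obtain ⟨w, z, hn'M, hrel⟩ := exists_coe_eq_upper_of_mem_unipotentU σ rfl hσσ hn'
  have hg' : g = τ * (τ⁻¹ * n * τ) * k := by rw [hgbk, hbnt]; group
  -- the split `u(w, z) = u(0, z + wσw∕2) · u(w, −wσw∕2)`
  have hσz : σ z = -z - w * σ w := by linear_combination hrel
  obtain ⟨n₁, hn₁⟩ := exists_coe_eq_of_sum σ rfl !![1, 0, z + w * σ w / 2; 0, 1, 0; 0, 0, 1]
    (by rw [Matrix.det_fin_three]; simp) (by
      intro a b
      fin_cases a <;> fin_cases b <;> simp [Fin.sum_univ_three, rev1'', rev2'', map_add, map_mul, map_div₀, map_ofNat, hσσ, hσz]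
      · field_simp; ring)
  obtain ⟨n₂, hn₂⟩ := exists_coe_eq_of_sum σ rfl !![1, w, -(w * σ w) / 2; 0, 1, -σ w; 0, 0, 1]
    (by rw [Matrix.det_fin_three]; simp) (by
      intro a b
      fin_cases a <;> fin_cases b <;> simp [Fin.sum_univ_three, rev1'', rev2'', map_neg, map_mul, map_div₀, map_ofNat, hσσ]
      all_goals (field_simp; ring))
  have hsplit : τ⁻¹ * n * τ = n₁ * n₂ := by
    apply Subtype.ext; apply Units.ext
    rw [hn'M, Subgroup.coe_mul, Units.val_mul, hn₁, hn₂]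
    ext i j
    fin_cases i <;> fin_cases j <;> simp [Matrix.mul_apply, Fin.sum_univ_three]
    ring
  have hn₁H := mem_centralizer_of_coe_eq_upper_zero σ hc hn₁
  by_cases hw : Valued.v w ≤ 1
  · -- `m = 0`: `u(w, −wσw∕2) ∈ K₀`
    obtain ⟨u₀, hu₀⟩ := exists_coe_eq_flickerU σ rfl hd hy 0
    have hu₀K : u₀ ∈ unitaryInt σ ((StdForm.antidiagonal 3).over K) := by
      rw [mem_unitaryInt_iff_forall_v_apply_le_one σ rfl hd.vσ]
      intro i j
      rw [hu₀]
      fin_cases i <;> fin_cases j <;> simp [hvy, hvσy]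
    have hn₂K : n₂ ∈ unitaryInt σ ((StdForm.antidiagonal 3).over K) := by
      rw [mem_unitaryInt_iff_forall_v_apply_le_one σ rfl hd.vσ]
      intro i j
      rw [hn₂]
      have hwσ : Valued.v (σ w) ≤ 1 := by rw [hd.vσ]; exact hw
      have hprod : Valued.v w * Valued.v (σ w) / Valued.v (2 : K) ≤ 1 := by
        rw [hd.v2, div_one]; exact mul_le_one' hw hwσ
      fin_cases i <;> fin_cases j <;> simp [hw, hwσ, hprod]
    refine ⟨0, τ * n₁, u₀, u₀⁻¹ * n₂ * k, Subgroup.mul_mem _ hτH hn₁H, hu₀,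
      Subgroup.mul_mem _ (Subgroup.mul_mem _ ((unitaryInt σ _).inv_mem hu₀K) hn₂K) hk, ?_⟩
    rw [hg', hsplit]; group
  · -- `|w| > 1`: `w ∕ y = ε ϖ^{-m}` with `m ≥ 1`, `|ε| = 1`
    have hw1 : 1 < Valued.v w := lt_of_not_ge hw
    have hw0 : w ≠ 0 := fun h0 => by rw [h0, map_zero] at hw1; exact not_lt_zero hw1
    obtain ⟨a0, ha0⟩ := WithZero.ne_zero_iff_exists.1 (ne_of_gt (lt_trans zero_lt_one hw1))
    set mz : ℤ := Multiplicative.toAdd a0 with hmzdef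
    have hvw : Valued.v w = WithZero.exp mz := by rw [← ha0]; rfl
    have hmz : 0 < mz := by rw [hvw, ← WithZero.exp_zero, WithZero.exp_lt_exp] at hw1; exact hw1
    obtain ⟨m, hm⟩ : ∃ m : ℕ, (m : ℤ) = mz := ⟨mz.toNat, Int.toNat_of_nonneg hmz.le⟩
    obtain ⟨α, hαdef⟩ : ∃ α : K, α = w / y := ⟨_, rfl⟩
    obtain ⟨ε, hεdef⟩ : ∃ ε : K, ε = α * ϖ ^ m := ⟨_, rfl⟩
    have hα0 : α ≠ 0 := by rw [hαdef]; exact div_ne_zero hw0 hy0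
    have hσα0 : σ α ≠ 0 := (map_ne_zero σ).2 hα0
    have ht0 : ϖ ^ m ≠ 0 := pow_ne_zero _ hϖ0
    have hσt : σ (ϖ ^ m) = ϖ ^ m := by rw [map_pow, hd.σϖ]
    have hε0 : ε ≠ 0 := by rw [hεdef]; exact mul_ne_zero hα0 ht0
    have hvε : Valued.v ε = 1 := by
      rw [hεdef, hαdef, map_mul, map_div₀, hvy, div_one, map_pow, hvw, hd.vϖ, ← WithZero.exp_nsmul, ← WithZero.exp_add,
        ← WithZero.exp_zero]
      congr 1
      simp [← hm]
    -- `a = d(α, 1, (σα)⁻¹) ∈ T ≤ H`, `u_m`, `k_ε = d(ε⁻¹, 1, σ ε) ∈ K₀`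
    obtain ⟨a, haT, ha⟩ := exists_coe_eq_diag σ rfl hσσ hα0 (β := 1) (by rw [map_one, one_mul])
    obtain ⟨um, hum⟩ := exists_coe_eq_flickerU σ rfl hd hy m
    obtain ⟨kε, -, hkε⟩ := exists_coe_eq_diag σ rfl hσσ (inv_ne_zero hε0) (β := 1) (by rw [map_one, one_mul])
    have hvσε : Valued.v (σ ε) = 1 := by rw [hd.vσ, hvε]
    have hkεK : kε ∈ unitaryInt σ ((StdForm.antidiagonal 3).over K) := by
      rw [mem_unitaryInt_iff_forall_v_apply_le_one σ rfl hd.vσ]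
      intro i j
      rw [hkε]
      fin_cases i <;> fin_cases j <;> simp [map_inv₀, hvε, hvσε]
    -- scalar identities behind `u(w, −wσw∕2) = a · u_m · k_ε`
    have hαy : α * y = w := by rw [hαdef]; field_simp
    have hσyσα : σ y * σ α = σ w := by rw [hαdef, map_div₀]; field_simp
    have hασα : α * σ α = -(w * σ w) / 2 := by
      have e : α * σ α * (y * σ y) = w * σ w := by
        calc α * σ α * (y * σ y) = (α * y) * (σ y * σ α) := by ring
          _ = w * σ w := by rw [hαy, hσyσα]
      rw [hy] at e
      field_simp
      linear_combination -e
    have hσε : σ ε = σ α * ϖ ^ m := by rw [hεdef, map_mul, hσt]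
    have hkε' : ((kε : GL (Fin 3) K) : Matrix (Fin 3) (Fin 3) K) = !![ε⁻¹, 0, 0; 0, 1, 0; 0, 0, σ α * ϖ ^ m] := by
      rw [hkε, map_inv₀, inv_inv, hσε]
    have hid : n₂ = a * um * kε := by
      apply Subtype.ext; apply Units.ext
      rw [Subgroup.coe_mul, Subgroup.coe_mul, Units.val_mul, Units.val_mul, hn₂, ha, hum, hkε']
      simp only [Matrix.mul_fin_three]
      ext i j
      fin_cases i <;> fin_cases j <;> simp only [Matrix.of_apply, Matrix.cons_val', Matrix.cons_val_zero, Matrix.cons_val_one,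
        Matrix.cons_val_fin_one, Matrix.cons_val, Matrix.empty_val', Fin.mk_one, Fin.zero_eta,
        Fin.reduceFinMk, mul_zero, zero_mul, add_zero, zero_add, mul_one, one_mul]
      · rw [hεdef]; field_simp
      · exact hαy.symm
      · rw [show α * (ϖ ^ m)⁻¹ * (σ α * ϖ ^ m) = α * σ α by field_simp]; exact hασα.symm
      · rw [show -σ y * (ϖ ^ m)⁻¹ * (σ α * ϖ ^ m) = -(σ y * σ α) by field_simp, hσyσα]
      · field_simp
    refine ⟨m, τ * n₁ * a, um, kε * k, Subgroup.mul_mem _ (Subgroup.mul_mem _ hτH hn₁H) (mem_centralizer_of_mem_torusU σ rfl hc haT),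
      hum, Subgroup.mul_mem _ hkεK hk, ?_⟩
    rw [hg', hsplit, hid]; group

end Setting

end UnitaryGroup

end Literature.NumberTheory.Automorphic
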